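import Summits.CriticalPhenomena.PercolationContinuityZ3.Theorems.PercNearOneGluingNoHeavyLowerTailCoSunflowerRows
import HarnessLib

/-!
# `NoHeavyLowerTail` (stmt-CriticalPhenomena-4575) — the increasing DUAL three-point Sahi row `T_inc` and its GROUP form,
# stated at measure level (E3GRP-by-switching line, seat `prim-e3grp-switch-1`)

Support file (`--supports stmt-CriticalPhenomena-4575`).  STATEMENTS FIRST (cell rule): the targets of the three-copy switching
certificates of run/shared/lean/prim/prim-e3grp/prim-e3grp-switch-1/PROOF-TINC.md are recorded here as named `Prop`s in the tree's
vocabulary (`sahiE3`, `prodBernoulli`, `openConn`); no new mathematical notion is introduced.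

* `TIncRow` (tree, `…CoSunflowerRows`, prim-e3grp-switch-3) — **(T_inc)** for every finite weighted graph and vertices `a b c`:
  `0 ≤ E₃({a↔b} ∪ {a↔c}, {a↔b} ∪ {b↔c}, {a↔c} ∪ {b↔c})` (each terminal joined to another one; three INCREASING
  events).  In the cells `q = μ(a|b|c)`, `u_v = μ(v cut from the other two, which are joined)`, `t = μ(abc)` this is
  `(1+q)(qt − e₂(u)) − e₃(u) ≥ 0`, the increasing dual of the tree theorem 3PT-LB `(1+t)(qt − e₂(u)) − e₃(u) ≥ 0`
  (`ThreePointLB.sahiE3_pairSep_nonneg`); the two are the only 3-point Sahi triples not implied by Harris + Aas–Gladkov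
  (prim-ineq-prove-2 MEMO-6).  The tree has it for graphs on `≤ 5` vertices (`SahiIncRows.tInc_le_five`, `native_decide`).
  PROVED for all finite graphs by a machine-checked three-copy switching certificate with reveal-only exploration steps
  (PROOF-TINC.md: exact cubic identity + finite abstract verification, two independent checkers; kit j081272/j081341) —
  the Lean replay of that certificate is pending (the `Prop` stays tagged `conjecture` in the tree until then).
  DEGENERATION: with `y` an isolated vertex the four-point E3GRP classes `γ` (row 46) and `α` (row 60) are literally
  `T_inc`, and rows `r4–r8` of `E3GroupSepCert.RowHolds` reduce to it by isolating/gluing two terminals — `T_inc` is the common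
  core of every open increasing E3GRP row.
* `GroupTIncRow` — the same with three vertex SETS `A B C` in place of `a b c`: `lnk[A|B∪C] = {some vertex of A is joined
  to some vertex of B ∪ C}` etc.  Instances: class `β` (rows 47–52; `A={a}, B={b}, C={c,y}`) and row `r5`
  (`{o,b}, {a₃}, {a₁,a₂}`).  OPEN (the group-exploration version of the certificate is being computed).
* `tIncRow_of_groupTIncRow` (singletons), `groupTIncRow_of_kahnConjecture`.  (This file adds only the GROUP form and the reduction.)
-/

noncomputable section

namespace Summit.CriticalPhenomena.PercolationContinuityZ3.Theorems

open MeasureTheory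
open Literature.Probability.LatticeModels (prodBernoulli sahiE3)
open Literature.Probability.Percolation

/-- **(group T_inc)**: for every finite weighted graph and vertex sets `A B C`,
`0 ≤ E₃(lnk[A|B∪C], lnk[B|A∪C], lnk[C|A∪B])` where `lnk[S|T] = {some vertex of S is joined to some vertex of T}`.
Contains E3GRP class `β` and row `r5`.  An instance of Kahn's Conjecture 5 / Sahi's `C_3`; OPEN.
[cite: Kahn2022, Conj. 5 (arXiv p. 3)] [status: open] -/
@[conjecture] def GroupTIncRow : Prop :=
  ∀ (V : Type) [Fintype V] (w : Sym2 V → unitInterval) (A B C : Set V),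
    0 ≤ sahiE3 (prodBernoulli w)
      {ω : BondConfig V | ∃ x ∈ A, ∃ y ∈ B ∪ C, (openGraph ω).Reachable x y}
      {ω : BondConfig V | ∃ x ∈ B, ∃ y ∈ A ∪ C, (openGraph ω).Reachable x y}
      {ω : BondConfig V | ∃ x ∈ C, ∃ y ∈ A ∪ B, (openGraph ω).Reachable x y}

/-- `lnk[{a} | {b} ∪ {c}] = {a↔b} ∪ {a↔c}`. [this work] -/
theorem setOf_exists_singleton_pair_reachable {V : Type} [Fintype V] (a b c : V) :
    {ω : BondConfig V | ∃ x ∈ ({a} : Set V), ∃ y ∈ ({b} : Set V) ∪ {c}, (openGraph ω).Reachable x y} =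
      openConn a b ∪ openConn a c := by
  ext ω
  simp only [Set.mem_setOf_eq, Set.mem_singleton_iff, Set.union_singleton, Set.mem_insert_iff,
    exists_eq_left, Set.mem_union, openConn, exists_eq_or_imp]
  tauto

/-- `openConn` is symmetric (as sets). [folklore] -/
theorem openConn_comm_set {V : Type} [Fintype V] (x y : V) : (openConn x y : Set (BondConfig V)) = openConn y x :=
  Set.ext fun _ => ⟨fun h => SimpleGraph.Reachable.symm h, fun h => SimpleGraph.Reachable.symm h⟩

/-- **group ⇒ point**: `GroupTIncRow → TIncRow` (singleton groups). [this work] -/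
theorem tIncRow_of_groupTIncRow (h : GroupTIncRow) : TIncRow := by
  intro V _ w a b c
  have h1 := h V w {a} {b} {c}
  have eb : {ω : BondConfig V | ∃ x ∈ ({b} : Set V), ∃ y ∈ ({a} : Set V) ∪ {c}, (openGraph ω).Reachable x y} =
      openConn a b ∪ openConn b c := by
    rw [setOf_exists_singleton_pair_reachable b a c, openConn_comm_set b a]
  have ec : {ω : BondConfig V | ∃ x ∈ ({c} : Set V), ∃ y ∈ ({a} : Set V) ∪ {b}, (openGraph ω).Reachable x y} =
      openConn a c ∪ openConn b c := by
    rw [setOf_exists_singleton_pair_reachable c a b, openConn_comm_set c a, openConn_comm_set c b]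
  rw [setOf_exists_singleton_pair_reachable a b c, eb, ec] at h1
  exact h1

/-- **Kahn's Conjecture 5 ⇒ (group T_inc)**. [cite: Kahn2022, Conj. 5 (arXiv p. 3)] -/
theorem groupTIncRow_of_kahnConjecture (hK : KahnConjecture) : GroupTIncRow := by
  intro V _ w A B C
  exact sahiE3_groupConn_nonneg_of_kahnConjecture hK w A (B ∪ C) B (A ∪ C) C (A ∪ B)

end Summit.CriticalPhenomena.PercolationContinuityZ3.Theorems
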